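import Mathlib.Data.Vector.Basic
import Mathlib.Data.Fintype.Vector
import Mathlib.Analysis.SpecialFunctions.Pow.Real
import Mathlib.Algebra.Field.GeomSum
import HarnessLib

/-!
# Zero windows in binary strings: renewal identities and partition-function bounds

Topic `Literature/Computability/AlgebraicComplexity`; the combinatorial core of the discharge of
`Literature.Barriers.ValiantsHypothesis.DepthReductionChasmDepthFour` (Kumar–Saraf 2017,
Cor. 1.3) via the sliding-window polynomial. For binary strings `g` (lists of `Bool`, `false`
playing the role of `0`) and a window parameter `t` we study

* `lead g` — the length of the initial run of `false`,
* `zwin t g` — the number of positions `p` with `g[p], …, g[p+t]` all `false` (all-zero windows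
  of length `t + 1`),

and the partition functions over strings of length `L`
`F(L) = ∑_g θ^{zwin g}`, `FA(L) = ∑_g θ^{zwin g + min(lead g, t)}`,
`Q(L) = ∑_g θ^{min(lead g,t) + zwin g + min(trail g, t)}` (`trail = lead ∘ reverse`).
Decomposing a string as `0^a 1 h` (or `0^L`) gives the renewal identities
`F(L) = θ^{L-t} + ∑_{a<L} θ^{a-t} F(L-1-a)` (`ℕ`-subtraction), `FA(L) = θ^L + ∑_{a<L} θ^a F(L-1-a)`,
`Q(L) = θ^{L+min(L,t)} + ∑_{a<L} θ^a FA(L-1-a)`, whence, for `1 ≤ θ < 2(1+η)`, `0 < η ≤ 1/2`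
and `6 ≤ (2+2η-θ) η θ^t`, the bounds `F(L) ≤ (2(1+η))^L`, `FA(L) ≤ θ^L + (2(1+η))^L/(2+2η-θ)`,
`Q(L) ≤ θ^{L+min(L,t)} + L θ^{L-1} + (2(1+η))^L/(2+2η-θ)²`, and for `2 ≤ θ ≤ 4`, `0 < ε ≤ 1`,
`10 ≤ ε² θ^t`, `F(L) ≤ (θ(1+ε))^L`. These are the deterministic replacements for the expectation
calculations of Kumar–Saraf 2017, §9 (`T₁, T₂, T₃` for `IMM`), for a de Bruijn (sliding
window) structure instead of random restrictions. Everything is elementary and proved.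

## References

* M. Kumar, S. Saraf, *On the power of homogeneous depth 4 arithmetic circuits*, SIAM J. Comput.
  46 (2017) 336–387, §8.5–§9 (the role of these sums).
-/

noncomputable section

namespace Literature.Computability.AlgebraicComplexity

namespace ZeroWindow

/-! ### `lead` and `zwin` -/

/-- The length of the initial run of `false` of a binary string. [folklore] -/
def lead : List Bool → ℕ
  | [] => 0
  | true :: _ => 0
  | false :: u => lead u + 1

/-- The number of all-`false` windows of length `t + 1` of a binary string (positions `p` with
`g[p] = ⋯ = g[p+t] = false`), by the recursion "a new window starts at the head iff the head is
`false` and the tail starts with `t` `false`s". [folklore] -/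
def zwin (t : ℕ) : List Bool → ℕ
  | [] => 0
  | b :: u => zwin t u + if b = false ∧ t ≤ lead u then 1 else 0

/-- `lead [] = 0`. [folklore] -/
@[simp] theorem lead_nil : lead [] = 0 := rfl
/-- A leading `true` stops the run. [folklore] -/
@[simp] theorem lead_cons_true (u : List Bool) : lead (true :: u) = 0 := rfl
/-- A leading `false` extends the run. [folklore] -/
@[simp] theorem lead_cons_false (u : List Bool) : lead (false :: u) = lead u + 1 := rfl
/-- `zwin [] = 0`. [folklore] -/
@[simp] theorem zwin_nil (t : ℕ) : zwin t [] = 0 := rfl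
/-- The recursion of `zwin`. [folklore] -/
theorem zwin_cons (t : ℕ) (b : Bool) (u : List Bool) :
    zwin t (b :: u) = zwin t u + if b = false ∧ t ≤ lead u then 1 else 0 := rfl
/-- No window starts at a `true`. [folklore] -/
@[simp] theorem zwin_cons_true (t : ℕ) (u : List Bool) : zwin t (true :: u) = zwin t u := by
  simp [zwin_cons]
/-- A window starts at a `false` iff `t` more `false`s follow. [folklore] -/
theorem zwin_cons_false (t : ℕ) (u : List Bool) :
    zwin t (false :: u) = zwin t u + if t ≤ lead u then 1 else 0 := by
  simp [zwin_cons]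

/-- `lead g ≤ |g|`. [folklore] -/
theorem lead_le_length : ∀ u : List Bool, lead u ≤ u.length
  | [] => le_rfl
  | true :: u => Nat.zero_le _
  | false :: u => by simpa using lead_le_length u

/-- `zwin g ≤ |g| - t`. [folklore] -/
theorem zwin_le : ∀ (t : ℕ) (u : List Bool), zwin t u ≤ u.length - t
  | _, [] => by simp
  | t, b :: u => by
    rw [zwin_cons, List.length_cons]
    have ih := zwin_le t u
    have hl := lead_le_length u
    split_ifs with h
    · omega
    · omega

/-- The leading run of `0^a`. [folklore] -/
@[simp] theorem lead_replicate (a : ℕ) : lead (List.replicate a false) = a := by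
  induction a with
  | zero => rfl
  | succ a ih => rw [List.replicate_succ, lead_cons_false, ih]

/-- The leading run of `0^a 1 h`. [folklore] -/
@[simp] theorem lead_replicate_append_true (a : ℕ) (h : List Bool) :
    lead (List.replicate a false ++ true :: h) = a := by
  induction a with
  | zero => rfl
  | succ a ih => rw [List.replicate_succ, List.cons_append, lead_cons_false, ih]

/-- The leading run stops at the first `true`, wherever the rest is. [folklore] -/
theorem lead_append_true_cons (A B : List Bool) : lead (A ++ true :: B) = lead A := by
  induction A with
  | nil => rfl
  | cons b A ih => cases b <;> simp [ih]

/-- Appending changes the leading run only of an all-`false` string. [folklore] -/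
theorem lead_append_singleton (u : List Bool) (b : Bool) :
    lead (u ++ [b]) = if lead u = u.length then u.length + (if b = false then 1 else 0)
      else lead u := by
  induction u with
  | nil => cases b <;> simp
  | cons c u ih =>
    cases c
    · simp only [List.cons_append, lead_cons_false, ih, List.length_cons]
      split_ifs <;> omega
    · simp

/-- The zero windows of `0^a`. [folklore] -/
@[simp] theorem zwin_replicate (t a : ℕ) : zwin t (List.replicate a false) = a - t := by
  induction a with
  | zero => simp
  | succ a ih =>
    rw [List.replicate_succ, zwin_cons_false, ih, lead_replicate]
    split_ifs with h <;> omega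

/-- The zero windows of `0^a 1 h`. [folklore] -/
theorem zwin_replicate_append_true (t a : ℕ) (h : List Bool) :
    zwin t (List.replicate a false ++ true :: h) = (a - t) + zwin t h := by
  induction a with
  | zero => simp
  | succ a ih =>
    rw [List.replicate_succ, List.cons_append, zwin_cons_false, ih, lead_replicate_append_true]
    split_ifs with h' <;> omega

/-- A string whose leading run is the whole string is `0^{|g|}`. [folklore] -/
theorem eq_replicate_of_lead_eq_length : ∀ u : List Bool, lead u = u.length →
    u = List.replicate u.length false
  | [], _ => rfl
  | true :: u, h => by simp at h
  | false :: u, h => by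
    have h' : lead u = u.length := by simpa using h
    rw [List.length_cons, List.replicate_succ]
    exact congrArg _ (eq_replicate_of_lead_eq_length u h')

/-- A string with a `true` is `0^{lead} 1 (rest)`. [folklore] -/
theorem eq_replicate_lead_append : ∀ u : List Bool, lead u < u.length →
    u = List.replicate (lead u) false ++ true :: u.drop (lead u + 1)
  | [], h => by simp at h
  | true :: u, _ => by simp
  | false :: u, h => by
    have h' : lead u < u.length := by simpa using h
    have ih := eq_replicate_lead_append u h'
    rw [lead_cons_false, List.replicate_succ, List.cons_append]
    exact congrArg _ (by simpa using ih)

/-! ### Reversal symmetry of `zwin` -/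

/-- **Snoc recursion**: a new window ends at an appended `false` iff the string ends with `t`
`false`s. [folklore] -/
theorem zwin_append_singleton (t : ℕ) (u : List Bool) (b : Bool) :
    zwin t (u ++ [b]) = zwin t u + if b = false ∧ t ≤ lead u.reverse then 1 else 0 := by
  induction u with
  | nil => cases b <;> simp [zwin_cons]
  | cons c u ih =>
    rw [List.cons_append, zwin_cons, ih, zwin_cons, List.reverse_cons, lead_append_singleton u b,
      lead_append_singleton u.reverse c, List.length_reverse]
    -- is `u` all `false`?
    by_cases hu : lead u = u.length
    · have hur : lead u.reverse = u.length := by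
        rw [eq_replicate_of_lead_eq_length u hu, List.reverse_replicate, lead_replicate,
          List.length_replicate]
      rw [if_pos hu, if_pos hur]
      cases b <;> cases c <;> simp <;> split_ifs <;> omega
    · have hur : lead u.reverse ≠ u.reverse.length := fun h => hu (by
        have := eq_replicate_of_lead_eq_length u.reverse h
        rw [List.length_reverse] at this
        have h2 : u = List.replicate u.length false := by
          conv_lhs => rw [← List.reverse_reverse u, this, List.reverse_replicate]
        conv_lhs => rw [h2]
        rw [lead_replicate])
      rw [List.length_reverse] at hur
      rw [if_neg hu, if_neg hur]
      cases b <;> cases c <;> simp [add_right_comm]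

/-- **`zwin` is invariant under reversal.** [folklore] -/
theorem zwin_reverse (t : ℕ) : ∀ u : List Bool, zwin t u.reverse = zwin t u
  | [] => rfl
  | b :: u => by
    rw [List.reverse_cons, zwin_append_singleton, zwin_reverse t u, List.reverse_reverse, zwin_cons]

/-! ### Sums over strings of a fixed length and the decomposition `0^a 1 h` -/

/-- The sum of a weight over all binary strings of length `L`. [folklore] -/
def strSum (L : ℕ) (Φ : List Bool → ℝ) : ℝ := ∑ g : List.Vector Bool L, Φ g.toList

/-- `strSum` is monotone in the weight. [folklore] -/
theorem strSum_le_strSum {L : ℕ} {Φ Ψ : List Bool → ℝ} (h : ∀ g : List Bool, g.length = L → Φ g ≤ Ψ g) :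
    strSum L Φ ≤ strSum L Ψ :=
  Finset.sum_le_sum fun g _ => h g.toList g.toList_length

/-- `strSum` of a non-negative weight is non-negative. [folklore] -/
theorem strSum_nonneg {L : ℕ} {Φ : List Bool → ℝ} (h : ∀ g : List Bool, 0 ≤ Φ g) : 0 ≤ strSum L Φ :=
  Finset.sum_nonneg fun g _ => h g.toList

/-- `strSum` is additive in the weight. [folklore] -/
theorem strSum_add (L : ℕ) (Φ Ψ : List Bool → ℝ) :
    strSum L (fun g => Φ g + Ψ g) = strSum L Φ + strSum L Ψ :=
  Finset.sum_add_distrib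

/-- `strSum` is homogeneous in the weight. [folklore] -/
theorem strSum_mul (L : ℕ) (c : ℝ) (Φ : List Bool → ℝ) :
    strSum L (fun g => c * Φ g) = c * strSum L Φ := by
  unfold strSum; rw [Finset.mul_sum]

/-- The number of binary strings of length `L`. [folklore] -/
theorem strSum_one (L : ℕ) : strSum L (fun _ => 1) = 2 ^ L := by
  unfold strSum
  rw [Finset.sum_const, Finset.card_univ, card_vector, Fintype.card_bool, nsmul_eq_mul, mul_one]
  push_cast
  rfl

/-- The string `0^a 1 h` of length `L`, for `|h| = L - 1 - a`, `a < L`. [folklore] -/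
def prepend {L : ℕ} (a : ℕ) (ha : a < L) (h : List.Vector Bool (L - 1 - a)) : List.Vector Bool L :=
  ⟨List.replicate a false ++ true :: h.toList, by
    rw [List.length_append, List.length_replicate, List.length_cons, h.toList_length]; omega⟩

/-- `prepend` is injective. [folklore] -/
theorem prepend_injective {L : ℕ} (a : ℕ) (ha : a < L) : Function.Injective (prepend a ha) := by
  intro h h' hh
  have := congrArg List.Vector.toList hh
  simp only [prepend, List.Vector.toList_mk, List.append_cancel_left_eq, List.cons.injEq,
    true_and] at this
  exact List.Vector.toList_injective this

/-- **The decomposition of a string by its leading run**: summing over all strings of length `L`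
is summing over `0^L` and over the strings `0^a 1 h`, `a < L`, `|h| = L - 1 - a`. [folklore] -/
theorem strSum_eq_lead_decomp (L : ℕ) (Φ : List Bool → ℝ) :
    strSum L Φ = Φ (List.replicate L false) +
      ∑ a ∈ Finset.range L, strSum (L - 1 - a)
        (fun h => Φ (List.replicate a false ++ true :: h)) := by
  classical
  unfold strSum
  -- split the strings by their leading run `a ∈ {0, …, L}`
  rw [← Finset.sum_fiberwise_of_maps_to (s := (Finset.univ : Finset (List.Vector Bool L)))
    (t := Finset.range (L + 1)) (g := fun g => lead g.toList)
    (fun g _ => Finset.mem_range.2 (Nat.lt_succ_of_le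
      (by simpa using lead_le_length g.toList))), Finset.sum_range_succ, add_comm]
  congr 1
  · -- the fiber `a = L` is `{0^L}`
    have hfib : (Finset.univ.filter fun g : List.Vector Bool L => lead g.toList = L) =
        {⟨List.replicate L false, by simp⟩} := by
      ext g
      simp only [Finset.mem_filter, Finset.mem_univ, true_and, Finset.mem_singleton]
      constructor
      · intro hg
        apply List.Vector.eq
        have h := eq_replicate_of_lead_eq_length g.toList (by rw [hg, g.toList_length])
        rw [g.toList_length] at h
        exact h
      · rintro rfl
        change lead (List.replicate L false) = L
        exact lead_replicate L
    rw [hfib, Finset.sum_singleton]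
    rfl
  · refine Finset.sum_congr rfl fun a ha => ?_
    rw [Finset.mem_range] at ha
    -- the fiber `a < L` is the image of `prepend a`
    have hfib : (Finset.univ.filter fun g : List.Vector Bool L => lead g.toList = a) =
        Finset.univ.image (prepend a ha) := by
      ext g
      simp only [Finset.mem_filter, Finset.mem_univ, true_and, Finset.mem_image]
      constructor
      · intro hg
        refine ⟨⟨g.toList.drop (a + 1), by rw [List.length_drop, g.toList_length]; omega⟩, ?_⟩
        apply List.Vector.eq
        change List.replicate a false ++ true :: g.toList.drop (a + 1) = g.toList
        conv_rhs => rw [eq_replicate_lead_append g.toList (by rw [hg, g.toList_length]; exact ha)]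
        rw [hg]
      · rintro ⟨h, rfl⟩
        exact lead_replicate_append_true a h.toList
    rw [hfib, Finset.sum_image fun h _ h' _ hh => prepend_injective a ha hh]
    rfl

/-! ### The partition functions and their renewal identities -/

/-- `F(L) = ∑_{|g| = L} θ^{zwin g}` — the free partition function. [folklore] -/
def F (θ : ℝ) (t L : ℕ) : ℝ := strSum L fun g => θ ^ zwin t g

/-- `FA(L) = ∑_{|g| = L} θ^{zwin g + min(lead g, t)}` — one end rewarded (a free stretch adjacent
to a forced zero window: the first `min(lead, t)` layers next to it also have zero windows).
[folklore] -/
def FA (θ : ℝ) (t L : ℕ) : ℝ := strSum L fun g => θ ^ (zwin t g + min (lead g) t)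

/-- `Q(L) = ∑_{|g| = L} θ^{min(lead g, t) + zwin g + min(trail g, t)}` — both ends rewarded (a
free stretch between two forced zero windows); `trail = lead ∘ reverse`. [folklore] -/
def Q (θ : ℝ) (t L : ℕ) : ℝ :=
  strSum L fun g => θ ^ (min (lead g) t + zwin t g + min (lead g.reverse) t)

/-- Non-negativity of `F`. [folklore] -/
theorem F_nonneg {θ : ℝ} (hθ : 0 ≤ θ) (t L : ℕ) : 0 ≤ F θ t L :=
  strSum_nonneg fun _ => pow_nonneg hθ _

/-- Non-negativity of `FA`. [folklore] -/
theorem FA_nonneg {θ : ℝ} (hθ : 0 ≤ θ) (t L : ℕ) : 0 ≤ FA θ t L :=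
  strSum_nonneg fun _ => pow_nonneg hθ _

/-- **Renewal identity for `F`**: `F(L) = θ^{L-t} + ∑_{a<L} θ^{a-t} F(L-1-a)` (`ℕ`-subtraction in
the exponents), from `zwin(0^L) = L - t` and `zwin(0^a 1 h) = (a - t) + zwin h`. [folklore] -/
theorem F_eq (θ : ℝ) (t L : ℕ) :
    F θ t L = θ ^ (L - t) + ∑ a ∈ Finset.range L, θ ^ (a - t) * F θ t (L - 1 - a) := by
  unfold F
  rw [strSum_eq_lead_decomp, zwin_replicate]
  congr 1
  refine Finset.sum_congr rfl fun a _ => ?_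
  rw [← strSum_mul]
  congr 1
  ext h
  rw [zwin_replicate_append_true, pow_add]

/-- **Renewal identity for `FA`**: `FA(L) = θ^{L} + ∑_{a<L} θ^{a} F(L-1-a)`. [folklore] -/
theorem FA_eq (θ : ℝ) (t L : ℕ) :
    FA θ t L = θ ^ L + ∑ a ∈ Finset.range L, θ ^ a * F θ t (L - 1 - a) := by
  unfold FA F
  rw [strSum_eq_lead_decomp, zwin_replicate, lead_replicate]
  congr 1
  · congr 1; omega
  · refine Finset.sum_congr rfl fun a _ => ?_
    rw [← strSum_mul]
    congr 1
    ext h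
    rw [zwin_replicate_append_true, lead_replicate_append_true, ← pow_add]
    congr 1; omega

/-- The trailing run of `0^a 1 h` is that of `h`. [folklore] -/
theorem lead_reverse_replicate_append_true (a : ℕ) (h : List Bool) :
    lead (List.replicate a false ++ true :: h).reverse = lead h.reverse := by
  rw [List.reverse_append, List.reverse_cons, List.append_assoc, List.singleton_append,
    lead_append_true_cons]

/-- `FA` computed from the trailing end equals `FA` (reversal symmetry). [folklore] -/
theorem strSum_trail_eq_FA (θ : ℝ) (t L : ℕ) :
    strSum L (fun g => θ ^ (zwin t g + min (lead g.reverse) t)) = FA θ t L := by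
  unfold FA strSum
  -- reindex by reversal
  refine Fintype.sum_equiv (Equiv.mk (fun g : List.Vector Bool L => g.reverse)
    (fun g => g.reverse) (fun g => ?_) (fun g => ?_)) _ _ (fun g => ?_)
  · apply List.Vector.eq; simp
  · apply List.Vector.eq; simp
  · change θ ^ (zwin t g.toList + min (lead g.toList.reverse) t) =
      θ ^ (zwin t (g.reverse).toList + min (lead (g.reverse).toList) t)
    simp only [List.Vector.toList_reverse, zwin_reverse]

/-- **Renewal identity for `Q`**: `Q(L) = θ^{L + min(L,t)} + ∑_{a<L} θ^{a} FA(L-1-a)`.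
[folklore] -/
theorem Q_eq (θ : ℝ) (t L : ℕ) :
    Q θ t L = θ ^ (L + min L t) + ∑ a ∈ Finset.range L, θ ^ a * FA θ t (L - 1 - a) := by
  unfold Q
  rw [strSum_eq_lead_decomp, zwin_replicate, lead_replicate, List.reverse_replicate, lead_replicate]
  congr 1
  · congr 1; omega
  · refine Finset.sum_congr rfl fun a _ => ?_
    rw [← strSum_trail_eq_FA, ← strSum_mul]
    congr 1
    ext h
    rw [zwin_replicate_append_true, lead_replicate_append_true, lead_reverse_replicate_append_true,
      ← pow_add]
    congr 1; omega

/-! ### Bounds -/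

section Bounds

open Finset

/-- `θ^{a ∸ t} ≤ 1 + θ^a θ^{-t}` for `θ ≥ 1` (the two cases `a ≤ t`, `a > t`). [folklore] -/
theorem pow_tsub_le {θ : ℝ} (hθ : 1 ≤ θ) (a t : ℕ) : θ ^ (a - t) ≤ 1 + θ ^ a * (θ ^ t)⁻¹ := by
  have hθ0 : 0 < θ := lt_of_lt_of_le one_pos hθ
  by_cases h : a ≤ t
  · rw [Nat.sub_eq_zero_of_le h, pow_zero]
    exact le_add_of_nonneg_right (by positivity)
  · push Not at h
    have : θ ^ (a - t) = θ ^ a * (θ ^ t)⁻¹ := by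
      rw [← div_eq_mul_inv, eq_div_iff (by positivity), ← pow_add, Nat.sub_add_cancel h.le]
    rw [this]
    exact le_add_of_nonneg_left zero_le_one

/-- `∑_{a<L} μ^{L-1-a} = (μ^L - 1)/(μ - 1)`. [folklore] -/
theorem sum_pow_rev_eq {μ : ℝ} (hμ : μ ≠ 1) (L : ℕ) :
    ∑ a ∈ range L, μ ^ (L - 1 - a) = (μ ^ L - 1) / (μ - 1) := by
  rw [Finset.sum_range_reflect (fun i => μ ^ i) L, geom_sum_eq hμ]

/-- `∑_{a<L} θ^a μ^{L-1-a} ≤ μ^L / (μ - θ)` for `0 ≤ θ < μ`. [folklore] -/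
theorem sum_pow_mul_pow_rev_le {θ μ : ℝ} (hθ : 0 ≤ θ) (hθμ : θ < μ) (L : ℕ) :
    ∑ a ∈ range L, θ ^ a * μ ^ (L - 1 - a) ≤ μ ^ L / (μ - θ) := by
  have hμ0 : 0 < μ := lt_of_le_of_lt hθ hθμ
  rcases Nat.eq_zero_or_pos L with rfl | hL
  · simp only [range_zero, sum_empty, pow_zero]
    exact div_nonneg zero_le_one (by linarith)
  · have hq : θ / μ < 1 := (div_lt_one hμ0).2 hθμ
    have hq0 : 0 ≤ θ / μ := div_nonneg hθ hμ0.le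
    have h1 : ∀ a ∈ range L, θ ^ a * μ ^ (L - 1 - a) = μ ^ (L - 1) * (θ / μ) ^ a := by
      intro a ha
      rw [mem_range] at ha
      rw [div_pow, mul_div_assoc', eq_div_iff (by positivity), mul_comm (μ ^ (L-1)), mul_assoc,
        ← pow_add, Nat.sub_add_cancel (by omega)]
    rw [sum_congr rfl h1, ← mul_sum, geom_sum_eq hq.ne]
    have h2 : ((θ / μ) ^ L - 1) / (θ / μ - 1) ≤ 1 / (1 - θ / μ) := by
      rw [show ((θ / μ) ^ L - 1) / (θ / μ - 1) = (1 - (θ / μ) ^ L) / (1 - θ / μ) by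
        rw [show (θ / μ) ^ L - 1 = -(1 - (θ / μ) ^ L) by ring,
          show θ / μ - 1 = -(1 - θ / μ) by ring, neg_div_neg_eq]]
      exact div_le_div_of_nonneg_right (by linarith [pow_nonneg hq0 L]) (by linarith)
    have h3 : 1 / (1 - θ / μ) = μ / (μ - θ) := by
      field_simp
    calc μ ^ (L - 1) * (((θ / μ) ^ L - 1) / (θ / μ - 1)) ≤ μ ^ (L - 1) * (1 / (1 - θ / μ)) :=
          mul_le_mul_of_nonneg_left h2 (by positivity)
      _ = μ ^ L / (μ - θ) := by
          rw [h3, ← mul_div_assoc, ← pow_succ, Nat.sub_add_cancel hL]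

/-- **The renewal step**: for `1 ≤ θ < μ = 2(1+η)`, `0 < η ≤ 1/2` and `6 ≤ (μ - θ) η θ^t`,
`θ^{L∸t} + ∑_{a<L} θ^{a∸t} μ^{L-1-a} ≤ μ^L`. [folklore] -/
theorem renewal_step_le {θ η : ℝ} (hθ : 1 ≤ θ) (hη0 : 0 < η) (hη : η ≤ 1 / 2)
    (hθμ : θ < 2 * (1 + η)) (t : ℕ) (hcond : 6 ≤ (2 * (1 + η) - θ) * η * θ ^ t) (L : ℕ) :
    θ ^ (L - t) + ∑ a ∈ range L, θ ^ (a - t) * (2 * (1 + η)) ^ (L - 1 - a) ≤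
      (2 * (1 + η)) ^ L := by
  set μ : ℝ := 2 * (1 + η) with hμ
  have hθ0 : 0 < θ := by linarith
  have hμ2 : 2 < μ := by rw [hμ]; linarith
  have hμ3 : μ ≤ 3 := by rw [hμ]; linarith
  rcases Nat.eq_zero_or_pos L with rfl | hL
  · simp
  set A : ℝ := μ ^ L with hA
  have hAμ : μ ≤ A := by
    rw [hA]
    calc μ = μ ^ 1 := (pow_one μ).symm
      _ ≤ μ ^ L := pow_le_pow_right₀ (by linarith) hL
  have hA2 : 2 ≤ A := by linarith
  have hmt : 0 < μ - θ := by linarith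
  have hT : (θ ^ t)⁻¹ * (3 / (μ - θ)) ≤ η / 2 := by
    have hpos : 0 < (μ - θ) * θ ^ t := by positivity
    rw [inv_mul_eq_div, div_div, div_le_div_iff₀ hpos two_pos]
    nlinarith
  -- bound each `θ^{a ∸ t}` by `1 + θ^a θ^{-t}` and sum
  have h1 : ∑ a ∈ range L, θ ^ (a - t) * μ ^ (L - 1 - a) ≤
      (A - 1) / (μ - 1) + (θ ^ t)⁻¹ * (A / (μ - θ)) := by
    calc ∑ a ∈ range L, θ ^ (a - t) * μ ^ (L - 1 - a)
        ≤ ∑ a ∈ range L, (1 + θ ^ a * (θ ^ t)⁻¹) * μ ^ (L - 1 - a) :=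
          sum_le_sum fun a _ => mul_le_mul_of_nonneg_right (pow_tsub_le hθ a t) (by positivity)
      _ = ∑ a ∈ range L, μ ^ (L - 1 - a) + (θ ^ t)⁻¹ * ∑ a ∈ range L, θ ^ a * μ ^ (L - 1 - a) := by
          rw [mul_sum, ← sum_add_distrib]
          refine sum_congr rfl fun a _ => ?_; ring
      _ ≤ (A - 1) / (μ - 1) + (θ ^ t)⁻¹ * (A / (μ - θ)) := by
          rw [sum_pow_rev_eq (by linarith)]
          exact add_le_add le_rfl (mul_le_mul_of_nonneg_left
            (sum_pow_mul_pow_rev_le hθ0.le (by linarith) L) (by positivity))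
  have h2 : θ ^ (L - t) ≤ 1 + A * (θ ^ t)⁻¹ := by
    refine (pow_tsub_le hθ L t).trans (add_le_add le_rfl (mul_le_mul_of_nonneg_right ?_ (by positivity)))
    exact pow_le_pow_left₀ hθ0.le (by linarith) L
  -- combine
  have e1 : θ ^ (L - t) + ∑ a ∈ range L, θ ^ (a - t) * μ ^ (L - 1 - a) ≤
      1 + (A - 1) / (μ - 1) + A * (θ ^ t)⁻¹ * (1 + 1 / (μ - θ)) := by
    calc _ ≤ (1 + A * (θ ^ t)⁻¹) + ((A - 1) / (μ - 1) + (θ ^ t)⁻¹ * (A / (μ - θ))) := add_le_add h2 h1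
      _ = _ := by ring
  have e2 : A * (θ ^ t)⁻¹ * (1 + 1 / (μ - θ)) ≤ A * (η / 2) := by
    have h13 : 1 + 1 / (μ - θ) ≤ 3 / (μ - θ) := by
      rw [show 1 + 1 / (μ - θ) = (μ - θ + 1) / (μ - θ) by field_simp]
      exact div_le_div_of_nonneg_right (by linarith) hmt.le
    calc A * (θ ^ t)⁻¹ * (1 + 1 / (μ - θ)) ≤ A * (θ ^ t)⁻¹ * (3 / (μ - θ)) :=
          mul_le_mul_of_nonneg_left h13 (by positivity)
      _ = A * ((θ ^ t)⁻¹ * (3 / (μ - θ))) := by ring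
      _ ≤ A * (η / 2) := mul_le_mul_of_nonneg_left hT (by positivity)
  have e3 : 1 + (A - 1) / (μ - 1) + A * (η / 2) ≤ A := by
    have hμ1 : μ - 1 = 1 + 2 * η := by rw [hμ]; ring
    rw [hμ1]
    have key : (A - 1) / (1 + 2 * η) ≤ A - 1 - A * (η / 2) := by
      rw [div_le_iff₀ (by linarith)]
      nlinarith [mul_nonneg hη0.le (sub_nonneg.2 hA2),
        mul_nonneg (mul_nonneg hη0.le (sub_nonneg.2 hη)) (le_trans zero_le_two hA2)]
    linarith
  linarith

/-- **The free partition function is nearly `2^L`**: for `1 ≤ θ < 2(1+η)`, `0 < η ≤ 1/2` and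
`6 ≤ (2 + 2η - θ) η θ^t`, `F(L) ≤ (2(1+η))^L` for all `L`. [folklore] -/
theorem F_le {θ η : ℝ} (hθ : 1 ≤ θ) (hη0 : 0 < η) (hη : η ≤ 1 / 2)
    (hθμ : θ < 2 * (1 + η)) (t : ℕ) (hcond : 6 ≤ (2 * (1 + η) - θ) * η * θ ^ t) :
    ∀ L, F θ t L ≤ (2 * (1 + η)) ^ L := by
  intro L
  induction L using Nat.strong_induction_on with
  | _ L ih =>
    rw [F_eq]
    refine le_trans (add_le_add le_rfl (sum_le_sum fun a ha => ?_))
      (renewal_step_le hθ hη0 hη hθμ t hcond L)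
    rw [mem_range] at ha
    exact mul_le_mul_of_nonneg_left (ih _ (by omega)) (pow_nonneg (by linarith) _)

/-- **One rewarded end**: under the hypotheses of `F_le`, `FA(L) ≤ θ^L + (2(1+η))^L/(2+2η-θ)`.
[folklore] -/
theorem FA_le {θ η : ℝ} (hθ : 1 ≤ θ) (hη0 : 0 < η) (hη : η ≤ 1 / 2)
    (hθμ : θ < 2 * (1 + η)) (t : ℕ) (hcond : 6 ≤ (2 * (1 + η) - θ) * η * θ ^ t) (L : ℕ) :
    FA θ t L ≤ θ ^ L + (2 * (1 + η)) ^ L / (2 * (1 + η) - θ) := by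
  rw [FA_eq]
  refine add_le_add le_rfl (le_trans (sum_le_sum fun a _ => ?_)
    (sum_pow_mul_pow_rev_le (by linarith) hθμ L))
  exact mul_le_mul_of_nonneg_left (F_le hθ hη0 hη hθμ t hcond _) (pow_nonneg (by linarith) _)

/-- **Two rewarded ends**: under the hypotheses of `F_le`,
`Q(L) ≤ θ^{L+min(L,t)} + L θ^{L-1} + (2(1+η))^L/(2+2η-θ)²`. [folklore] -/
theorem Q_le {θ η : ℝ} (hθ : 1 ≤ θ) (hη0 : 0 < η) (hη : η ≤ 1 / 2)
    (hθμ : θ < 2 * (1 + η)) (t : ℕ) (hcond : 6 ≤ (2 * (1 + η) - θ) * η * θ ^ t) (L : ℕ) :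
    Q θ t L ≤ θ ^ (L + min L t) + L * θ ^ (L - 1) +
      (2 * (1 + η)) ^ L / (2 * (1 + η) - θ) ^ 2 := by
  set μ : ℝ := 2 * (1 + η) with hμ
  have hθ0 : 0 ≤ θ := by linarith
  rw [Q_eq, add_assoc]
  refine add_le_add le_rfl ?_
  calc ∑ a ∈ range L, θ ^ a * FA θ t (L - 1 - a)
      ≤ ∑ a ∈ range L, θ ^ a * (θ ^ (L - 1 - a) + μ ^ (L - 1 - a) / (μ - θ)) :=
        sum_le_sum fun a _ => mul_le_mul_of_nonneg_left (FA_le hθ hη0 hη hθμ t hcond _)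
          (pow_nonneg hθ0 _)
    _ = ∑ a ∈ range L, θ ^ (L - 1) + (1 / (μ - θ)) * ∑ a ∈ range L, θ ^ a * μ ^ (L - 1 - a) := by
        rw [mul_sum, ← sum_add_distrib]
        refine sum_congr rfl fun a ha => ?_
        rw [mem_range] at ha
        rw [mul_add, ← pow_add, Nat.add_sub_cancel' (by omega)]
        ring
    _ ≤ L * θ ^ (L - 1) + (1 / (μ - θ)) * (μ ^ L / (μ - θ)) := by
        rw [sum_const, card_range, nsmul_eq_mul]
        exact add_le_add le_rfl (mul_le_mul_of_nonneg_left (sum_pow_mul_pow_rev_le hθ0 hθμ L)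
          (div_nonneg zero_le_one (by linarith)))
    _ = L * θ ^ (L - 1) + μ ^ L / (μ - θ) ^ 2 := by rw [one_div_mul_eq_div, div_div, sq]

/-- **The renewal step for `θ ≥ 2`**: for `2 ≤ θ ≤ 4`, `0 < ε ≤ 1`, `ν = θ(1+ε)` and
`10 ≤ ε² θ^t`, `θ^{L∸t} + ∑_{a<L} θ^{a∸t} ν^{L-1-a} ≤ ν^L`. [folklore] -/
theorem renewal_step_le' {θ ε : ℝ} (hθ2 : 2 ≤ θ) (hθ4 : θ ≤ 4) (hε0 : 0 < ε) (hε1 : ε ≤ 1)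
    (t : ℕ) (hcond : 10 ≤ ε ^ 2 * θ ^ t) (L : ℕ) :
    θ ^ (L - t) + ∑ a ∈ range L, θ ^ (a - t) * (θ * (1 + ε)) ^ (L - 1 - a) ≤
      (θ * (1 + ε)) ^ L := by
  set ν : ℝ := θ * (1 + ε) with hν
  have hθ0 : 0 < θ := by linarith
  have hθ1 : 1 ≤ θ := by linarith
  have hνθ : θ < ν := by rw [hν]; nlinarith
  have hν2 : 2 < ν := by linarith
  rcases Nat.eq_zero_or_pos L with rfl | hL
  · simp
  set A : ℝ := ν ^ L with hA
  have hAν : ν ≤ A := by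
    rw [hA]
    calc ν = ν ^ 1 := (pow_one ν).symm
      _ ≤ ν ^ L := pow_le_pow_right₀ (by linarith) hL
  have hA2 : 2 ≤ A := by linarith
  have hmt : ν - θ = θ * ε := by rw [hν]; ring
  -- bound each `θ^{a ∸ t}` by `1 + θ^a θ^{-t}` and sum
  have h1 : ∑ a ∈ range L, θ ^ (a - t) * ν ^ (L - 1 - a) ≤
      (A - 1) / (ν - 1) + (θ ^ t)⁻¹ * (A / (ν - θ)) := by
    calc ∑ a ∈ range L, θ ^ (a - t) * ν ^ (L - 1 - a)
        ≤ ∑ a ∈ range L, (1 + θ ^ a * (θ ^ t)⁻¹) * ν ^ (L - 1 - a) :=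
          sum_le_sum fun a _ => mul_le_mul_of_nonneg_right (pow_tsub_le hθ1 a t) (by positivity)
      _ = ∑ a ∈ range L, ν ^ (L - 1 - a) + (θ ^ t)⁻¹ * ∑ a ∈ range L, θ ^ a * ν ^ (L - 1 - a) := by
          rw [mul_sum, ← sum_add_distrib]
          refine sum_congr rfl fun a _ => ?_; ring
      _ ≤ (A - 1) / (ν - 1) + (θ ^ t)⁻¹ * (A / (ν - θ)) := by
          rw [sum_pow_rev_eq (by linarith)]
          exact add_le_add le_rfl (mul_le_mul_of_nonneg_left
            (sum_pow_mul_pow_rev_le hθ0.le hνθ L) (by positivity))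
  have h2 : θ ^ (L - t) ≤ 1 + A * (θ ^ t)⁻¹ := by
    refine (pow_tsub_le hθ1 L t).trans (add_le_add le_rfl (mul_le_mul_of_nonneg_right ?_ (by positivity)))
    exact pow_le_pow_left₀ hθ0.le hνθ.le L
  have e1 : θ ^ (L - t) + ∑ a ∈ range L, θ ^ (a - t) * ν ^ (L - 1 - a) ≤
      1 + (A - 1) / (ν - 1) + A * (θ ^ t)⁻¹ * (1 + 1 / (ν - θ)) := by
    calc _ ≤ (1 + A * (θ ^ t)⁻¹) + ((A - 1) / (ν - 1) + (θ ^ t)⁻¹ * (A / (ν - θ))) := add_le_add h2 h1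
      _ = _ := by ring
  -- `A θ^{-t} (1 + 1/(θ ε)) ≤ A ε / ν` from `10 ≤ ε² θ^t`
  have e2 : A * (θ ^ t)⁻¹ * (1 + 1 / (ν - θ)) ≤ A * (ε / ν) := by
    rw [hmt, mul_assoc]
    refine mul_le_mul_of_nonneg_left ?_ (by positivity)
    rw [show (1 : ℝ) + 1 / (θ * ε) = (θ * ε + 1) / (θ * ε) by field_simp, ← div_eq_inv_mul, div_div,
      div_le_div_iff₀ (by positivity) (by positivity), hν]
    -- `(θ ε + 1) · θ (1 + ε) ≤ ε · (θ^t · (θ ε))`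
    have hε2 : ε ^ 2 * θ ^ t * (θ * ε) ≥ 10 * (θ * ε) :=
      mul_le_mul_of_nonneg_right hcond (by positivity)
    nlinarith [mul_nonneg hθ0.le hε0.le, mul_nonneg (mul_nonneg hθ0.le hε0.le) hε0.le,
      mul_le_mul hθ4 hε1 hε0.le (by linarith : (0:ℝ) ≤ 4)]
  have e3 : 1 + (A - 1) / (ν - 1) + A * (ε / ν) ≤ A := by
    have hν1 : 0 < ν - 1 := by linarith
    have hν0 : 0 < ν := by linarith
    have key : (A - 1) / (ν - 1) ≤ A - 1 - A * (ε / ν) := by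
      rw [div_le_iff₀ hν1]
      have hAeν : A * (ε / ν) * (ν - 1) ≤ A * ε := by
        rw [mul_assoc]
        refine mul_le_mul_of_nonneg_left ?_ (by linarith)
        rw [div_mul_eq_mul_div, div_le_iff₀ hν0]
        nlinarith
      -- `A - 1 ≤ (A - 1)(ν - 1) - A ε`, i.e. `A ε ≤ (A-1)(ν-2)`, and `ν - 2 ≥ 2 ε`, `A - 1 ≥ A/2`
      have hν2ε : 2 * ε ≤ ν - 2 := by rw [hν]; nlinarith
      nlinarith [mul_le_mul_of_nonneg_left hν2ε (by linarith : (0:ℝ) ≤ A - 1),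
        mul_nonneg hε0.le (by linarith : (0:ℝ) ≤ A - 2)]
    linarith
  linarith

/-- **The free partition function for `θ ≥ 2`**: for `2 ≤ θ ≤ 4`, `0 < ε ≤ 1` and
`10 ≤ ε² θ^t`, `F(L) ≤ (θ(1+ε))^L` for all `L`. [folklore] -/
theorem F_le' {θ ε : ℝ} (hθ2 : 2 ≤ θ) (hθ4 : θ ≤ 4) (hε0 : 0 < ε) (hε1 : ε ≤ 1)
    (t : ℕ) (hcond : 10 ≤ ε ^ 2 * θ ^ t) : ∀ L, F θ t L ≤ (θ * (1 + ε)) ^ L := by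
  intro L
  induction L using Nat.strong_induction_on with
  | _ L ih =>
    rw [F_eq]
    refine le_trans (add_le_add le_rfl (sum_le_sum fun a ha => ?_))
      (renewal_step_le' hθ2 hθ4 hε0 hε1 t hcond L)
    rw [mem_range] at ha
    exact mul_le_mul_of_nonneg_left (ih _ (by omega)) (pow_nonneg (by linarith) _)

end Bounds

end ZeroWindow

end Literature.Computability.AlgebraicComplexity
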